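import Summits.CriticalPhenomena.PercolationContinuityZ3.Theorems.Transplant.KNCells2ChainSched
import HarnessLib

/-!
# Corridor chain, the constant planar schedule OVER THE PLANAR CELLS of p3-g2 (`a = du.1`, `σ = sgOf du`, `c = cen x`, `r = 4t`):
# the regions lie in `Q_x ∪ H_{x,y}`, the first core is `M_x`, the last lies in `M_y ∩ H_{x,y}`
# (companion of `KNCells2ChainSched`; design HOME/prim-bschramm-p2-g2/F8-DESIGN.md §9)

builds on p205010 (kernel theorem, internal audit signed; external expert review pending) — nothing in this file uses p205010.
Lane `prim-bschramm`, seat `prim-bschramm-p2` (Corridor-over-levels); helper file (`--supports stmt-CriticalPhenomena-4575`).  Pure `Site 2` geometry.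

* `qBox_eq_Q`, `mBox_eq_M`, `slab_subset_M` — the signed boxes around `cen x` versus p3-g2's `PCells.Q / M` (and `Hfull`, definitional);
* `region_subset_Q_union_Hfull`, `core_zero_eq_M`, `core_last_subset_M`, `core_last_subset_Hfull` for the schedule `Sched` with `C.r = 4t`.
[cite: KozmaNitzan2024, §4 p. 26 (the cells), Lemmas 11–12]
-/

noncomputable section

namespace Summit.CriticalPhenomena.PercolationContinuityZ3.Theorems

namespace Transplant

namespace ChainPlanar

open Literature.Probability.Percolation Literature.Probability.LatticeModels
open Literature.Probability.Percolation.KozmaNitzan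
open Literature.Probability.Percolation.KozmaNitzan.Cells (oth oth_ne eq_oth_of_ne sgOf sgOf_sign)

variable (C : PCells) (x : Site 2) (du : MDir)

/-- A centred square of half-width `w` around `cen x` in signed form. [folklore] -/
theorem sqBox_eq (w : ℕ) :
    sBox du.1 (sgOf du) (C.cen x) (-(w : ℤ)) w w = Finset.Icc (C.cen x - ((w : ℕ) : Site 2)) (C.cen x + ((w : ℕ) : Site 2)) := by
  ext y
  rw [PCells.mem_psBox_iff, PCells.mem_sq_iff]
  constructor
  · rintro ⟨h1, h2⟩ i
    by_cases hi : i = du.1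
    · subst hi; rcases sgOf_sign du with h | h <;> rw [h] at h1 <;> constructor <;> linarith [h1.1, h1.2]
    · rw [eq_oth_of_ne hi]; exact h2
  · intro h
    refine ⟨?_, h _⟩
    have := h du.1
    rcases sgOf_sign du with h' | h' <;> rw [h'] <;> constructor <;> linarith [this.1, this.2]

/-- The `5r`-box around `cen x` in signed form is `Q_x`. [cite: KozmaNitzan2024, §4 p. 26 (Q_v)] -/
theorem qBox_eq_Q : sBox du.1 (sgOf du) (C.cen x) (-((5 * C.r : ℕ) : ℤ)) (5 * C.r : ℕ) (5 * C.r : ℕ) = C.Q x :=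
  sqBox_eq C x du (5 * C.r)

/-- The `3r`-box around `cen x` in signed form is `M_x`. [cite: KozmaNitzan2024, §4 p. 26 (M_v)] -/
theorem mBox_eq_M : sBox du.1 (sgOf du) (C.cen x) (-((3 * C.r : ℕ) : ℤ)) (3 * C.r : ℕ) (3 * C.r : ℕ) = C.M x :=
  sqBox_eq C x du (3 * C.r)

/-- The slab `{17r ≤ level ≤ 22r, |trans| ≤ 2r}` lies in `M_y`, `y = x + du`. [cite: KozmaNitzan2024, §4 p. 26 (M_v)] -/
theorem slab_subset_M : sBox du.1 (sgOf du) (C.cen x) (17 * C.r) (22 * C.r) (2 * C.r) ⊆ C.M (x + stepVec du) := by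
  intro y hy
  rw [PCells.mem_psBox_iff] at hy
  obtain ⟨h1, h2⟩ := hy
  rw [PCells.M, PCells.mem_sq_iff]
  push_cast
  intro i
  have hr0 : (0 : ℤ) ≤ C.r := by positivity
  by_cases hi : i = du.1
  · subst hi
    rw [C.cen_add_stepVec_fst]
    rcases sgOf_sign du with h | h <;> rw [h] at h1 ⊢ <;> constructor <;> linarith [h1.1, h1.2]
  · rw [eq_oth_of_ne hi, C.cen_add_stepVec_oth]
    constructor <;> linarith [h2.1, h2.2]

namespace Sched

variable {C x du} {t R' : ℕ} (hr : C.r = 4 * t) (hR : 100 * R' ≤ t)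
include hr hR

/-- **The regions lie in `Q_x ∪ H_{x,y}`.** [cite: KozmaNitzan2024, §4 p. 26, p. 30 (E_i ∪ E_{v,x} ∪ H_{x,y})] -/
theorem region_subset_Q_union_Hfull {i : ℕ} (hi : i ≤ nLast) :
    region t R' du.1 (sgOf du) (C.cen x) i ⊆ C.Q x ∪ C.Hfull x du := by
  refine (region_subset_boxes (sgOf_sign du) _ hR hi).trans ?_
  rw [← qBox_eq_Q C x du, PCells.Hfull]
  have e1 : ((5 * C.r : ℕ) : ℤ) = 20 * t := by rw [hr]; push_cast; ring
  have e2 : (5 * C.r : ℤ) = 20 * t := by rw [hr]; push_cast; ring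
  have e3 : (22 * C.r : ℤ) = 88 * t := by rw [hr]; push_cast; ring
  have e4 : (2 * C.r : ℤ) = 8 * t := by rw [hr]; push_cast; ring
  rw [e1, e2, e3, e4]

/-- **The first core is `M_x`.** [cite: KozmaNitzan2024, §4 p. 26] -/
theorem core_zero_eq_M : core t R' du.1 (sgOf du) (C.cen x) 0 = C.M x := by
  rw [core_zero (sgOf_sign du) _ hR, ← mBox_eq_M C x du]
  have e : ((3 * C.r : ℕ) : ℤ) = 12 * t := by rw [hr]; push_cast; ring
  rw [e]

/-- **The last core lies in `M_y`.** [cite: KozmaNitzan2024, §4 p. 26] -/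
theorem core_last_subset_M : core t R' du.1 (sgOf du) (C.cen x) (nLast + 1) ⊆ C.M (x + stepVec du) := by
  refine (core_last_subset (sgOf_sign du) _ hR).trans ?_
  have e2 : (68 * t : ℤ) = 17 * C.r := by rw [hr]; push_cast; ring
  have e3 : (88 * t : ℤ) = 22 * C.r := by rw [hr]; push_cast; ring
  have e4 : (8 * t : ℤ) = 2 * C.r := by rw [hr]; push_cast; ring
  rw [e2, e3, e4]
  exact slab_subset_M C x du

/-- **The last core lies in `H_{x,y}`.** [cite: KozmaNitzan2024, §4 p. 26] -/
theorem core_last_subset_Hfull : core t R' du.1 (sgOf du) (C.cen x) (nLast + 1) ⊆ C.Hfull x du := by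
  refine (core_last_subset (sgOf_sign du) _ hR).trans ?_
  rw [PCells.Hfull]
  have ht : (1 : ℤ) ≤ t := by have := C.one_le_r; omega
  exact sBox_mono (sgOf_sign du) _ (by rw [hr]; push_cast; linarith) (by rw [hr]; push_cast; linarith)
    (by rw [hr]; push_cast; linarith)

end Sched

end ChainPlanar

end Transplant

end Summit.CriticalPhenomena.PercolationContinuityZ3.Theorems

end
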